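import Summits.Langlands.Statement
import Literature.NumberTheory.Automorphic.ReciprocityGLnRankOneProofs
import Literature.NumberTheory.Automorphic.ReciprocityGLnRestrictionProofs
import Literature.NumberTheory.Automorphic.AlgebraicityParityGL
import Literature.NumberTheory.GaloisRepresentations.FramedGaloisRepSemisimplification
import Literature.NumberTheory.GaloisRepresentations.TateTwistFrobeniusProofs
import Literature.NumberTheory.GaloisRepresentations.WeakAbelianDirectSummand
import HarnessLib

/-!
# Seed transport: avatars pass along an a.e.-twisted weak base change `P ≃ BC_K(π₀) ⊗ χ`
(crux stmt-Langlands-27035 `SeedParityLadder.HolomorphicSeedAvatars`, line `birth`, stub₂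
`stub_seedTransport` — registered signature `SeedTransport`, proved here VERBATIM and unconditionally)

Setting: number fields `K₀ ⊆ K`, an automorphic representation datum `P` of `GL₂(𝔸_K)`, a cuspidal
`π₀` on `GL₂(𝔸_{K₀})`, an automorphic datum `χ` of `GL₁(𝔸_K)` which is `L`-algebraic, a prime `ℓ`,
`ι : ℚ̄_ℓ ≃ ℂ`, and an `ℓ`-adic `r : Γ_{K₀} → GL₂(ℚ̄_ℓ)` attached to `π₀` at almost all places
(`Summit.Langlands.SatakeFrobCompatibleAt ι π₀ r u`: unramified, arithmetic-Frobenius polynomial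
`arithFrobPolyOfSatake ι q_u 1 α_u`).  Hypothesis (the hull's a.e. relation): at almost every place `w`
of `K`, whenever `π₀` has Satake parameter `α` at the place `u` of `K₀` below `w` and `χ` has Satake
parameter `{c}` at `w`, `P` has Satake parameter `(α^{f(w|u)}) · c` at `w`.  Conclusion: some SEMISIMPLE
`ρ : Γ_K → GL₂(ℚ̄_ℓ)` is attached to `P` at almost all places.

Proof (class field theory + linear algebra; every input is PROVED in the tree):
* **Weil's avatar of `χ`** (`exists_character_of_isLAlgebraic_glOne`): `χ` has a Hecke character `η`
  (`AutomorphicRepData.exists_heckeCharacter_glOne`), algebraic because `χ` is `L` = `C`-algebraic in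
  rank one (`IsLAlgebraic.isCAlgebraic_of_odd`, `isAlgebraic_heckeCharacter_glOne_of_isCAlgebraic`);
  Weil's `ℓ`-adic character of `η` (`HeckeCharacter.IsAlgebraic.exists_lAdic`, Weil 1956) is, off `ℓ`
  and the level, unramified with Frobenius value `ι⁻¹(η(ϖ_w))⁻¹`, and `{η(ϖ_w)}` is the Satake
  parameter of `χ` at `w` (`eventually_hasSatakeParamAt_glOne`).
* **Restriction** (`hasFrobCharpolyAt_restrictField_arithFrobPolyOfSatake`, Arthur–Clozel (1.1) on the
  Galois side): `r|_{Γ_K}` is unramified at `w ∣ u` with Frobenius polynomial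
  `arithFrobPolyOfSatake ι q_w 1 (α^{f(w|u)})`.
* **Twist** `r|_{Γ_K} ⊗ ψ` (`FramedRep.twist`): unramified (`FramedGaloisRep.isUnramifiedAt_twist`),
  Frobenius roots rescaled by `ι⁻¹(c)⁻¹` (`FramedGaloisRep.hasFrobCharpolyAt_twist_of_eq_prod`), which
  is exactly `arithFrobPolyOfSatake ι q_w 1 ((α^{f}) · c)` (`arithFrobPolyOfSatake_one`).
* **Semisimplification** `ρ := (r|_{Γ_K} ⊗ ψ)^{ss}` (`FramedGaloisRep.exists_semisimplification`,
  Deligne–Serre 1974, 6.12): semisimple, unramified where the twist is, same Frobenius polynomials.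
  (So the stub's hypothesis "`r` semisimple" is idle; with it one could equally take `r|_{Γ_K} ⊗ ψ`
  itself, by Clifford's theorem.)
* Cofinite bookkeeping: the places above the finitely many bad places of `K₀`
  (`HeightOneSpectrum.tendsto_under_cofinite`) and above `ℓ` (`Ideal.finite_factors`) are finitely many.

References: A. Weil, *On a certain type of characters of the idèle-class group of an algebraic
number-field* (1956) §1–2; J.-P. Serre, *Abelian ℓ-adic representations* (1968) Ch. I §2.3, Ch. II;
J. Arthur, L. Clozel, Ann. of Math. Stud. 120 (1989) Ch. 3 (1.1); P. Deligne, J.-P. Serre, ASENS 7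
(1974), 6.12.
-/

noncomputable section

set_option linter.dupNamespace false

open scoped MatrixGroups Matrix NumberField Polynomial Classical
open NumberField IsDedekindDomain Field Polynomial Filter
open Literature.NumberTheory.Automorphic Literature.NumberTheory.GaloisRepresentations

namespace Summit.Langlands.Langlands.Theorems.HolomorphicSeedAvatars

/-! ## 1. Weil: the `ℓ`-adic character of an `L`-algebraic datum of `GL₁`, as a continuous character -/

section Avatar

variable {K : Type} [Field K] [NumberField K] {h₁ : isCompact_glFiniteIntegralLevel 1 K}
  {ℓ : ℕ} [Fact ℓ.Prime]

/-- **Weil's avatar of an `L`-algebraic automorphic datum of `GL₁(𝔸_K)`, as a continuous character**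
`ψ : Γ_K →ₜ* ℚ̄_ℓˣ`: at almost every finite place `w`, `χ` has a Satake parameter `{c}`, `ψ` kills the
inertia groups above `w`, and `ψ(Frob_w) = ι⁻¹(c)⁻¹` for every arithmetic Frobenius above `w` — the
determinant of Weil's `ℓ`-adic character of the (algebraic) Hecke character of `χ`
(`HeckeCharacter.IsAlgebraic.exists_lAdic`), read through `{η(ϖ_w)} =` Satake parameter
(`eventually_hasSatakeParamAt_glOne`). [cite: Weil1956, §1–§2]
[cite: SerreAbelianLadic1968, Ch. II §2.7–2.8] -/
theorem exists_character_of_isLAlgebraic_glOne (χ : AutomorphicRepData (AutomorphyDatum.gl 1 K h₁))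
    (hχ : χ.IsLAlgebraic) (ι : PadicAlgCl ℓ ≃+* ℂ) :
    ∃ ψ : absoluteGaloisGroup K →ₜ* (PadicAlgCl ℓ)ˣ,
      ∀ᶠ w : HeightOneSpectrum (𝓞 K) in cofinite, ∃ c : ℂ, χ.HasSatakeParamAt w {c} ∧
        (∀ 𝔓 ∈ w.primesAbove, ∀ σ ∈ 𝔓.inertia (absoluteGaloisGroup K), ψ σ = 1) ∧
        (∀ 𝔓 ∈ w.primesAbove, ∀ σ : absoluteGaloisGroup K, IsArithFrobAt (𝓞 K) σ 𝔓 →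
          (ψ σ : PadicAlgCl ℓ) = ι.symm c⁻¹) := by
  obtain ⟨η, hη⟩ := χ.exists_heckeCharacter_glOne
  have halg : η.IsAlgebraic :=
    χ.isAlgebraic_heckeCharacter_glOne_of_isCAlgebraic hη (hχ.isCAlgebraic_of_odd odd_one)
  obtain ⟨ψ₁, hψ₁⟩ := halg.exists_lAdic ι
  refine ⟨FramedRep.det ψ₁, ?_⟩
  -- the places above `ℓ` are finitely many (Mathlib `Ideal.finite_factors`)
  have hℓ : ∀ᶠ w : HeightOneSpectrum (𝓞 K) in cofinite, ((ℓ : ℕ) : 𝓞 K) ∉ w.asIdeal := by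
    have hne : (Ideal.span {((ℓ : ℕ) : 𝓞 K)} : Ideal (𝓞 K)) ≠ ⊥ := by
      rw [Ne, Ideal.span_singleton_eq_bot, Nat.cast_eq_zero]
      exact (Fact.out : ℓ.Prime).ne_zero
    refine Filter.mem_of_superset (Ideal.finite_factors hne).compl_mem_cofinite ?_
    intro v hv hmem
    exact hv (Ideal.dvd_span_singleton.2 hmem)
  filter_upwards [hℓ, χ.eventually_hasSatakeParamAt_glOne hη] with w hwℓ hw
  obtain ⟨ϖ, hϖ⟩ := exists_valuation_eq_exp_neg_one K w
  have hsat : χ.HasSatakeParamAt w {((η (localUnits w ϖ) : ℂˣ) : ℂ)} := hw ϖ hϖ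
  have hur : η.IsUnramifiedAt w := χ.isUnramifiedAt_heckeCharacter_glOne hη hsat
  obtain ⟨hunr, hfrob⟩ := hψ₁ w hwℓ hur
  have hc : ((η (localUnits w ϖ) : ℂˣ) : ℂ) = η.valueAtUniformizer w := by
    rw [← HeckeCharacter.localComponent_eq_valueAtUniformizer hur hϖ,
      HeckeCharacter.localComponent_apply]
  refine ⟨_, hsat, fun 𝔓 h𝔓 σ hσ => ?_, fun 𝔓 h𝔓 σ hσ => ?_⟩
  · rw [FramedRep.det_apply, hunr 𝔓 h𝔓 σ hσ, map_one]
  · have h := hfrob 𝔓 h𝔓 σ hσ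
    rw [FramedGaloisRep.charpoly_eq_X_sub_C_det, sub_right_inj, C_inj] at h
    rw [FramedRep.det_apply, h, hc]

end Avatar

/-! ## 2. The transport -/

section Transport

/-- Rewriting of the predicted polynomial: `arithFrobPolyOfSatake ι q 1 α = ∏_{a ∈ α} (X - ι⁻¹(a⁻¹))`
as a product over the multiset `α.map (ι⁻¹ ·⁻¹)`. [folklore] -/
theorem arithFrobPolyOfSatake_one_eq_prod_map {ℓ : ℕ} [Fact ℓ.Prime] (ι : PadicAlgCl ℓ ≃+* ℂ) (q : ℕ)
    (α : Multiset ℂ) :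
    arithFrobPolyOfSatake ι q 1 α = ((α.map fun a ↦ ι.symm a⁻¹).map fun b ↦ X - C b).prod := by
  rw [arithFrobPolyOfSatake_one, Multiset.map_map]
  rfl

/-- Twisting the Satake multiset by `c` rescales the roots `ι⁻¹(a⁻¹)` by `ι⁻¹(c)⁻¹`. [folklore] -/
theorem arithFrobPolyOfSatake_one_map_mul {ℓ : ℕ} [Fact ℓ.Prime] (ι : PadicAlgCl ℓ ≃+* ℂ) (q : ℕ)
    (α : Multiset ℂ) (c : ℂ) :
    arithFrobPolyOfSatake ι q 1 (α.map (c * ·)) =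
      ((α.map fun a ↦ ι.symm a⁻¹).map fun b ↦ X - C (ι.symm c⁻¹ * b)).prod := by
  rw [arithFrobPolyOfSatake_one, Multiset.map_map, Multiset.map_map]
  congr 1
  refine Multiset.map_congr rfl fun a _ ↦ ?_
  simp only [Function.comp_apply, mul_inv, map_mul]

/-- **Seed transport** (stub₂ of line `birth` of crux `HolomorphicSeedAvatars`, registered signature
`SeedTransport`, verbatim): along an a.e.-twisted weak base change relation `P_w ↔ (α_u^{f(w|u)}) · c_w`
from an arbitrary subfield `K₀ ⊆ K`, an `ℓ`-adic `r` attached to `π₀` at almost all places of `K₀`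
yields a semisimple `ρ` attached to `P` at almost all places of `K`: `ρ := (r|_{Γ_K} ⊗ ψ_χ)^{ss}`,
`ψ_χ` being Weil's `ℓ`-adic character of the `L`-algebraic `GL₁` datum `χ`
(`exists_character_of_isLAlgebraic_glOne`); Frobenius bookkeeping `Frob_w ↦ Frob_u^{f(w|u)}`
(`hasFrobCharpolyAt_restrictField_arithFrobPolyOfSatake`), twist
(`FramedGaloisRep.hasFrobCharpolyAt_twist_of_eq_prod`), semisimplification
(`FramedGaloisRep.exists_semisimplification`; the hypothesis "`r` semisimple" is not needed).
[cite: Weil1956, §1–§2] [cite: ArthurClozel1989, Ch. 3, (1.1)] [cite: DeligneSerreASENS1974, 6.12] -/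
theorem stub_seedTransport :
    ∀ (K₀ : Type) [Field K₀] [NumberField K₀] (K : Type) [Field K] [NumberField K] [Algebra K₀ K] (hcpt : Literature.NumberTheory.Automorphic.isCompact_glFiniteIntegralLevel 2 K) (P : Literature.NumberTheory.Automorphic.AutomorphicRepData (Literature.NumberTheory.Automorphic.AutomorphyDatum.gl 2 K hcpt)) (ℓ : ℕ) [Fact ℓ.Prime] (ι : PadicAlgCl ℓ ≃+* ℂ) (h₀ : Literature.NumberTheory.Automorphic.isCompact_glFiniteIntegralLevel 2 K₀) (π₀ : Literature.NumberTheory.Automorphic.CuspidalAutomorphicRepData 2 K₀ h₀) (h₁ : Literature.NumberTheory.Automorphic.isCompact_glFiniteIntegralLevel 1 K) (χ : Literature.NumberTheory.Automorphic.AutomorphicRepData (Literature.NumberTheory.Automorphic.AutomorphyDatum.gl 1 K h₁)) (r : Literature.NumberTheory.GaloisRepresentations.FramedGaloisRep K₀ (PadicAlgCl ℓ) 2), r.toGaloisRep.IsSemisimple → (∀ᶠ u : IsDedekindDomain.HeightOneSpectrum (NumberField.RingOfIntegers K₀) in Filter.cofinite, Summit.Langlands.SatakeFrobCompatibleAt ι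 π₀.1 r u) → χ.IsLAlgebraic → (∀ᶠ w : IsDedekindDomain.HeightOneSpectrum (NumberField.RingOfIntegers K) in Filter.cofinite, ∀ (u : IsDedekindDomain.HeightOneSpectrum (NumberField.RingOfIntegers K₀)) (α : Multiset ℂ) (c : ℂ), w.asIdeal.under (NumberField.RingOfIntegers K₀) = u.asIdeal → π₀.1.HasSatakeParamAt u α → χ.HasSatakeParamAt w {c} → P.HasSatakeParamAt w ((α.map (· ^ w.asIdeal.inertiaDeg (NumberField.RingOfIntegers K₀))).map (c * ·))) → ∃ ρ : Literature.NumberTheory.GaloisRepresentations.FramedGaloisRep K (PadicAlgCl ℓ) 2, ρ.toGaloisRep.IsSemisimple ∧ ∀ᶠ v : IsDedekindDomain.HeightOneSpectrum (NumberField.RingOfIntegers K) in Filter.cofinite, Summit.Langlands.SatakeFrobCompatibleAt ι P ρ v := by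
  intro K₀ _ _ K _ _ _ hcpt P ℓ _ ι h₀ π₀ h₁ χ r _ hr hχ hrel
  obtain ⟨ψ, hψ⟩ := exists_character_of_isLAlgebraic_glOne χ hχ ι
  obtain ⟨ρ, hss, -, -, hunr, hcp⟩ :=
    FramedGaloisRep.exists_semisimplification (FramedRep.twist (r.restrictField K) ψ)
  refine ⟨ρ, hss, ?_⟩
  have hr' : ∀ᶠ w : HeightOneSpectrum (𝓞 K) in cofinite,
      Summit.Langlands.SatakeFrobCompatibleAt ι π₀.1 r (w.under (𝓞 K₀)) :=
    (HeightOneSpectrum.tendsto_under_cofinite (𝓞 K₀) (B := 𝓞 K)).eventually hr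
  filter_upwards [hr', hψ, hrel] with w hw hψw hrelw
  obtain ⟨α, hα, hur, hfrob⟩ := hw
  obtain ⟨c, hc, hψI, hψF⟩ := hψw
  have hwu : w.asIdeal.under (𝓞 K₀) = (w.under (𝓞 K₀)).asIdeal := rfl
  have hP := hrelw (w.under (𝓞 K₀)) α c hwu hα hc
  obtain ⟨hur', h2⟩ := hasFrobCharpolyAt_restrictField_arithFrobPolyOfSatake ι r hwu hur 1 hfrob
  refine ⟨_, hP, hunr w (FramedGaloisRep.isUnramifiedAt_twist hur' hψI), hcp w _ ?_⟩
  rw [arithFrobPolyOfSatake_one_eq_prod_map] at h2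
  rw [arithFrobPolyOfSatake_one_map_mul]
  exact FramedGaloisRep.hasFrobCharpolyAt_twist_of_eq_prod h2 hψF

end Transport

end Summit.Langlands.Langlands.Theorems.HolomorphicSeedAvatars

end
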